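import Literature.AlgebraicGeometry.Modules.AffineLocalizing
import Literature.AlgebraicGeometry.Modules.FiniteType
import Literature.AlgebraicGeometry.Modules.QcohLocalization
import Mathlib.RingTheory.Localization.Finiteness
import HarnessLib

/-!
# Sections over a basic open are a localization; finite type is affine-local

Hartshorne, *Algebraic Geometry* II, Lemma 5.3 / Prop. 5.4 (pp. 112–113); The Stacks Project,
Tag 01XZ: for a quasi-coherent `M` on an affine `V = Spec B` and `g ∈ B`, `Γ(D(g), M) = Γ(V, M)_g`;
and "finite type" for quasi-coherent modules is local: if `M` is quasi-coherent and every point has a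
neighbourhood basis of affine opens `W` with `Γ(W, M)` finitely generated, then `Γ(V, M)` is finitely
generated for EVERY affine open `V` (a module which is finitely generated after localization at a
family `(g_i)` generating the unit ideal is finitely generated, Mathlib
`Module.Finite.of_localizationSpan'`).

For the tree's affine-local notions (`IsAffineLocalizing`, `IsAffineFiniteType`):

* `IsAffineLocalizing.isLocalizedModule_basicOpen` — **the restriction
  `Γ(V, M) → Γ(D(g), M)` is a localization at `g`** (`IsLocalizedModule (powers g)`), for the
  `Γ(V, 𝒪_X)`-module structure on `Γ(D(g), M)` through `Γ(V, 𝒪) → Γ(D(g), 𝒪)` (`moduleBasicOpen`,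
  Mathlib's `algebra_section_section_basicOpen`);
* `IsAffineLocalizing.moduleFinite_basicOpen` — hence `Γ(D(g), M)` is finitely generated if
  `Γ(V, M)` is;
* `IsAffineFiniteType.of_basis` — **finite type is affine-local**: for `M` affine-localizing, if
  every point has arbitrarily small affine neighbourhoods `W` with `Γ(W, M)` finitely generated,
  then `M` is of affine-finite type.

Everything is proved; no named facts. Mathlib searched (pin v4.32): `IsLocalizedModule`,
`Module.Finite.of_isLocalizedModule`, `Module.Finite.of_localizationSpan'`,
`IsAffineOpen.isLocalization_basicOpen`, `IsAffineOpen.self_le_iSup_basicOpen_iff`,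
`RingedSpace.isUnit_res_basicOpen` (used).

## References

* R. Hartshorne, *Algebraic Geometry*, GTM 52 (1977), II Lemma 5.3, Prop. 5.4 (pp. 112–113).
  [Hartshorne1977]
* The Stacks Project, Tag 01XZ (finite type modules). [StacksProject]
-/

noncomputable section

-- `TopCat.Presheaf`/`Scheme.Modules` are not reducible (as in Mathlib's `AlgebraicGeometry/Modules`).
set_option backward.isDefEq.respectTransparency false

open CategoryTheory AlgebraicGeometry TopologicalSpace Opposite

universe u

namespace Literature.AlgebraicGeometry.Modules

variable {X : Scheme.{u}} (M : X.Modules) {V : X.Opens} (g : Γ(X, V))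

/-! ## `Γ(D(g), M)` as a `Γ(V, 𝒪_X)`-module -/

/-- The `Γ(V, 𝒪_X)`-module structure on `Γ(D(g), M)` through the restriction `Γ(V, 𝒪) → Γ(D(g), 𝒪)`
(the algebra structure is Mathlib's `algebra_section_section_basicOpen`). [folklore] -/
abbrev moduleBasicOpen : Module Γ(X, V) Γ(M, X.basicOpen g) :=
  Module.compHom _ (X.presheaf.map (homOfLE (X.basicOpen_le g)).op).hom

attribute [local instance] moduleBasicOpen

/-- The `Γ(V, 𝒪)`-action on `Γ(D(g), M)` is through restriction. [folklore] -/
theorem moduleBasicOpen_smul_def (r : Γ(X, V)) (m : Γ(M, X.basicOpen g)) :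
    r • m = X.presheaf.map (homOfLE (X.basicOpen_le g)).op r • m := rfl

/-- The tower `Γ(V, 𝒪) → Γ(D(g), 𝒪) ↷ Γ(D(g), M)`. [folklore] -/
instance isScalarTower_basicOpen : IsScalarTower Γ(X, V) Γ(X, X.basicOpen g) Γ(M, X.basicOpen g) :=
  ⟨fun r s m => by
    rw [moduleBasicOpen_smul_def, Algebra.smul_def, mul_smul]
    rfl⟩

/-- **The restriction `Γ(V, M) → Γ(D(g), M)` as a `Γ(V, 𝒪_X)`-linear map.** [folklore] -/
def resBasicOpen : Γ(M, V) →ₗ[Γ(X, V)] Γ(M, X.basicOpen g) where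
  toFun m := M.presheaf.map (homOfLE (X.basicOpen_le g)).op m
  map_add' m m' := map_add _ m m'
  map_smul' r m := by rw [Scheme.Modules.map_smul]; rfl

/-- `resBasicOpen` is restriction. [folklore] -/
@[simp]
theorem resBasicOpen_apply (m : Γ(M, V)) :
    resBasicOpen M g m = M.presheaf.map (homOfLE (X.basicOpen_le g)).op m := rfl

variable {M}

/-- **`Γ(D(g), M) = Γ(V, M)_g` for `M` affine-localizing and `V` affine** (Hartshorne II Lemma 5.3):
the restriction is a localization at `g`. [cite: Hartshorne1977, II Lemma 5.3 (p. 112)] -/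
theorem IsAffineLocalizing.isLocalizedModule_basicOpen (hM : IsAffineLocalizing M)
    (hV : IsAffineOpen V) : IsLocalizedModule (Submonoid.powers g) (resBasicOpen M g) := by
  constructor
  · rintro ⟨_, n, rfl⟩
    have hu : IsUnit (X.presheaf.map (homOfLE (X.basicOpen_le g)).op g ^ n) :=
      (X.toLocallyRingedSpace.toRingedSpace.isUnit_res_basicOpen g).pow n
    obtain ⟨u, hu⟩ := hu
    refine ⟨⟨algebraMap _ (Module.End Γ(X, V) Γ(M, X.basicOpen g)) (g ^ n),
      (u⁻¹ : (Γ(X, X.basicOpen g))ˣ) • LinearMap.id, ?_, ?_⟩, rfl⟩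
    · ext m
      change g ^ n • ((↑u⁻¹ : Γ(X, X.basicOpen g)) • m) = m
      rw [moduleBasicOpen_smul_def, map_pow, ← hu, smul_smul, Units.mul_inv, one_smul]
    · ext m
      change (↑u⁻¹ : Γ(X, X.basicOpen g)) • (g ^ n • m) = m
      rw [moduleBasicOpen_smul_def, map_pow, ← hu, smul_smul, Units.inv_mul, one_smul]
  · intro s
    obtain ⟨n, x, hx⟩ := hM.numerator hV g rfl s
    refine ⟨⟨x, ⟨g ^ n, n, rfl⟩⟩, ?_⟩
    change g ^ n • s = M.presheaf.map (homOfLE (X.basicOpen_le g)).op x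
    rw [hx, moduleBasicOpen_smul_def, map_pow]
  · intro x₁ x₂ h
    have h0 : M.presheaf.map (homOfLE (X.basicOpen_le g)).op (x₁ - x₂) = 0 := by
      rw [map_sub, sub_eq_zero]; exact h
    obtain ⟨n, hn⟩ := hM.torsion hV g _ (X.basicOpen_le g) le_rfl h0
    refine ⟨⟨g ^ n, n, rfl⟩, ?_⟩
    change g ^ n • x₁ = g ^ n • x₂
    rw [← sub_eq_zero, ← smul_sub, hn]

/-- **`Γ(D(g), M)` is finitely generated if `Γ(V, M)` is** (`M` affine-localizing, `V` affine).
[cite: Hartshorne1977, II Prop. 5.4 (p. 113)] -/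
theorem IsAffineLocalizing.moduleFinite_basicOpen (hM : IsAffineLocalizing M) (hV : IsAffineOpen V)
    [Module.Finite Γ(X, V) Γ(M, V)] :
    Module.Finite Γ(X, X.basicOpen g) Γ(M, X.basicOpen g) := by
  haveI := hV.isLocalization_basicOpen g
  haveI := hM.isLocalizedModule_basicOpen g hV
  exact Module.Finite.of_isLocalizedModule (Submonoid.powers g) (resBasicOpen M g)

/-! ## Finite type is affine-local -/

/-- **Finite type is affine-local** (The Stacks Project, Tag 01XZ): if `M` is affine-localizing and
every point has arbitrarily small affine neighbourhoods `W` with `Γ(W, M)` finitely generated, then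
`Γ(V, M)` is finitely generated for every affine open `V` (cover `V` by basic opens `D(g) ⊆ W`,
then `Γ(D(g), M) = Γ(W, M)_{g}` is finitely generated and Mathlib
`Module.Finite.of_localizationSpan'`). [cite: StacksProject, Tag 01XZ] -/
theorem IsAffineFiniteType.of_basis (hM : IsAffineLocalizing M)
    (h : ∀ (x : X) (O : X.Opens), x ∈ O → ∃ W : X.Opens, IsAffineOpen W ∧ x ∈ W ∧ W ≤ O ∧
      Module.Finite Γ(X, W) Γ(M, W)) :
    IsAffineFiniteType M := by
  intro V hV
  -- around each point of `V`: an affine `W ⊆ V` with `Γ(W, M)` f.g., and a basic open `D(g) ⊆ W`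
  have key : ∀ x ∈ V, ∃ g : Γ(X, V), x ∈ X.basicOpen g ∧
      Module.Finite Γ(X, X.basicOpen g) Γ(M, X.basicOpen g) := by
    intro x hx
    obtain ⟨W, hW, hxW, hWV, hfin⟩ := h x V hx
    obtain ⟨g, hgW, hxg⟩ := hV.exists_basicOpen_le ⟨x, hxW⟩ hx
    refine ⟨g, hxg, ?_⟩
    -- `D_V(g) = D_W(g|_W)`
    have hD : X.basicOpen (X.presheaf.map (homOfLE hWV).op g) = X.basicOpen g := by
      rw [Scheme.basicOpen_res]
      exact inf_eq_right.mpr hgW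
    have hfin' := hM.moduleFinite_basicOpen (X.presheaf.map (homOfLE hWV).op g) hW
    rw [hD] at hfin'
    exact hfin'
  choose g hxg hfin using key
  let s : Set Γ(X, V) := Set.range fun x : V => g x.1 x.2
  have hspan : Ideal.span s = ⊤ := by
    rw [← hV.self_le_iSup_basicOpen_iff]
    intro x hx
    exact Opens.mem_iSup.mpr ⟨⟨g x hx, ⟨x, hx⟩, rfl⟩, hxg x hx⟩
  haveI : ∀ r : s, IsLocalization.Away r.val Γ(X, X.basicOpen r.val) := fun r =>
    hV.isLocalization_basicOpen r.val
  haveI : ∀ r : s, IsLocalizedModule (Submonoid.powers r.val) (resBasicOpen M r.val) := fun r =>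
    hM.isLocalizedModule_basicOpen r.val hV
  refine Module.Finite.of_localizationSpan' s hspan (Rₚ := fun r : s => Γ(X, X.basicOpen r.val))
    (fun r : s => resBasicOpen M r.val) fun r => ?_
  obtain ⟨⟨x, hx⟩, hr⟩ := r.2
  have e : g x hx = r.val := hr
  rw [← e]
  exact hfin x hx

end Literature.AlgebraicGeometry.Modules

end
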